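import Summits.KontsevichZagierPeriods.Zeta5Search.WedgeDictionaryRankThreeMinors
import Summits.KontsevichZagierPeriods.Zeta5Search.XSaveConjectures
import HarnessLib

/-!
# An Apéry-type determinant identity along slot 7 for Brown–Zudilin's `Q(a)` and the dictionary `P̂` (cell `pub-zeta5`, P1)

HONEST FRAMING: systematic search; no irrationality claim unless certified.

OUR work (Summit side, P1 seat generation 4; planner gen-1 g5's memo `D2-FEASIBILITY-g5.md` §3 checked this identity at
11/11 points with Brown–Zudilin's `P̂` from the corrected (22′)).  Lowering `a₇` (`a 6` in `Fin 8` indexing) by one raises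
the dual slot `b₇` by one and fixes the other slots (`bOfA_lower6`).  With the `Q`-part of the wedge dictionary — a THEOREM,
`OmegaRec.qPart_holds`: `Q(a) = ρ(a)·M₃(b(a))` — the Plücker identity `quadM3_casUV_step` and CF-W3 give, UNCONDITIONALLY,

  `Q(a)·P̂_dict(a′) − P̂_dict(a)·Q(a′) = ρ(a)ρ(a′) · U(b′) · C₃(b)`,   `a′ = a − e₇`, `b = b(a)`, `b′ = b + e₇ = b(a′)`,

where `Q = QOf` is Brown–Zudilin's genuine coefficient (17), `P̂_dict(a) = XSave.PhatOf a 7 = ρ(a)(U(b)V(b′) − U(b′)V(b))` is the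
DICTIONARY's `ζ(3)`-numerator (equal to Brown–Zudilin's `P̂(a)` only under the conjectural `P̂`-part, D2 — NOT claimed), and
`C₃ = cas3` has the closed form of `rankThreeClosedForm_holds`.  Under D2 this is the Apéry-type identity
`Q P̂′ − P̂ Q′ = ρρ′U′C₃` of the memo; here it is a theorem about `Q` and the dictionary side.  No irrationality content.
-/

open Finset

namespace Summit.KontsevichZagierPeriods.Zeta5Search.WedgeDictionary

open Summit.KontsevichZagierPeriods.Zeta5Search.DualSeries
open Literature.NumberTheory.Irrationality.BrownZudilin2022 (bOfA Converges QOf)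

/-- Lowering `a 6` by one raises the dual slot `7` by one and fixes the others: `b(a − e₇) = b(a) + e₇`. -/
theorem bOfA_lower6 (a : Fin 8 → ℤ) : bOfA (Function.update a 6 (a 6 - 1)) = bump (bOfA a) 6 := by
  funext j
  rcases j with _ | _ | _ | _ | _ | _ | _ | _ | k
  all_goals simp [bOfA, bump]
  ring

/-- **Apéry-type determinant identity along slot 7** (unconditional form): for `a` and `a′ = a − e₇` both in the region of
the `Q`-part (`Converges`, `0 ≤ 2b_i ≤ b₀ + 1`), with `d(b(a)) ≥ 1` and `b₇ + 1 ≤ b₀`: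
`Q(a)·P̂_dict(a′) − P̂_dict(a)·Q(a′) = ρ(a)ρ(a′)·U(b(a′))·C₃(b(a))`. -/
theorem apery_determinant_slot7 (a : Fin 8 → ℤ) (hconv : Converges a)
    (hreg : ∀ i ∈ Icc 1 7, 0 ≤ bOfA a i ∧ 2 * bOfA a i ≤ bOfA a 0 + 1) (h0 : 0 ≤ bOfA a 0) (hd : 1 ≤ dOf (bOfA a))
    (h7 : bOfA a 7 + 1 ≤ bOfA a 0)
    (hconv' : Converges (Function.update a 6 (a 6 - 1)))
    (hreg' : ∀ i ∈ Icc 1 7, 0 ≤ bOfA (Function.update a 6 (a 6 - 1)) i ∧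
      2 * bOfA (Function.update a 6 (a 6 - 1)) i ≤ bOfA (Function.update a 6 (a 6 - 1)) 0 + 1) :
    (QOf a : ℚ) * XSave.PhatOf (Function.update a 6 (a 6 - 1)) 7 -
        XSave.PhatOf a 7 * QOf (Function.update a 6 (a 6 - 1)) =
      rhoOf a * rhoOf (Function.update a 6 (a 6 - 1)) * (coeffU (bump (bOfA a) 6) * cas3 (bOfA a)) := by
  set a' := Function.update a 6 (a 6 - 1) with ha'
  have hb' : bOfA a' = bump (bOfA a) 6 := bOfA_lower6 a
  have hInBox : InBox (bOfA a) :=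
    ⟨h0, fun j hj => ⟨(hreg (j + 1) (mem_Icc.2 ⟨by omega, by have := mem_range.1 hj; omega⟩)).1, by
      have := (hreg (j + 1) (mem_Icc.2 ⟨by omega, by have := mem_range.1 hj; omega⟩)).2; linarith⟩⟩
  have hd' : 0 ≤ dOf (bOfA a') := by rw [hb', dOf_bump _ (mem_range.2 (by norm_num))]; omega
  have hQ := OmegaRec.qPart_holds a hconv hreg (by omega)
  have hQ' := OmegaRec.qPart_holds a' hconv' hreg' hd'
  rw [hb'] at hQ'
  have hP : XSave.PhatOf a 7 = rhoOf a * casUV (bOfA a) := rfl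
  have hP' : XSave.PhatOf a' 7 = rhoOf a' * casUV (bump (bOfA a) 6) := by
    show rhoOf a' * _ = _
    rw [hb']
    rfl
  have key := quadM3_casUV_step (bOfA a) hInBox hd h7
  rw [hQ, hQ', hP, hP']
  linear_combination (rhoOf a * rhoOf a') * key

/-- **The two companions** (memo §3 "and two more with W, V"), unconditional dictionary-side forms with
`P_dict(a) = XSave.POf a 7 = ρ(a)(W(b′)V(b) − W(b)V(b′))`:
`Q(a)·P_dict(a′) − P_dict(a)·Q(a′) = −ρ(a)ρ(a′)·W(b′)·C₃(b)` and
`P̂_dict(a)·P_dict(a′) − P_dict(a)·P̂_dict(a′) = −ρ(a)ρ(a′)·V(b′)·C₃(b)` (`a′ = a − e₇`, `b′ = b(a) + e₇`). -/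
theorem apery_determinant_slot7_companions (a : Fin 8 → ℤ) (hconv : Converges a)
    (hreg : ∀ i ∈ Icc 1 7, 0 ≤ bOfA a i ∧ 2 * bOfA a i ≤ bOfA a 0 + 1) (h0 : 0 ≤ bOfA a 0) (hd : 1 ≤ dOf (bOfA a))
    (h7 : bOfA a 7 + 1 ≤ bOfA a 0)
    (hconv' : Converges (Function.update a 6 (a 6 - 1)))
    (hreg' : ∀ i ∈ Icc 1 7, 0 ≤ bOfA (Function.update a 6 (a 6 - 1)) i ∧
      2 * bOfA (Function.update a 6 (a 6 - 1)) i ≤ bOfA (Function.update a 6 (a 6 - 1)) 0 + 1) :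
    ((QOf a : ℚ) * XSave.POf (Function.update a 6 (a 6 - 1)) 7 -
        XSave.POf a 7 * QOf (Function.update a 6 (a 6 - 1)) =
      -(rhoOf a * rhoOf (Function.update a 6 (a 6 - 1)) * (coeffW (bump (bOfA a) 6) * cas3 (bOfA a)))) ∧
    (XSave.PhatOf a 7 * XSave.POf (Function.update a 6 (a 6 - 1)) 7 -
        XSave.POf a 7 * XSave.PhatOf (Function.update a 6 (a 6 - 1)) 7 =
      -(rhoOf a * rhoOf (Function.update a 6 (a 6 - 1)) * (coeffV (bump (bOfA a) 6) * cas3 (bOfA a)))) := by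
  set a' := Function.update a 6 (a 6 - 1) with ha'
  have hb' : bOfA a' = bump (bOfA a) 6 := bOfA_lower6 a
  have hInBox : InBox (bOfA a) :=
    ⟨h0, fun j hj => ⟨(hreg (j + 1) (mem_Icc.2 ⟨by omega, by have := mem_range.1 hj; omega⟩)).1, by
      have := (hreg (j + 1) (mem_Icc.2 ⟨by omega, by have := mem_range.1 hj; omega⟩)).2; linarith⟩⟩
  have hd' : 0 ≤ dOf (bOfA a') := by rw [hb', dOf_bump _ (mem_range.2 (by norm_num))]; omega
  have hQ := OmegaRec.qPart_holds a hconv hreg (by omega)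
  have hQ' := OmegaRec.qPart_holds a' hconv' hreg' hd'
  rw [hb'] at hQ'
  have hP : XSave.POf a 7 = rhoOf a * casVW (bOfA a) := by
    show rhoOf a * (coeffW _ * coeffV _ - coeffW _ * coeffV _) = _
    unfold casVW bump
    ring
  have hP' : XSave.POf a' 7 = rhoOf a' * casVW (bump (bOfA a) 6) := by
    show rhoOf a' * (coeffW _ * coeffV _ - coeffW _ * coeffV _) = _
    rw [hb']
    unfold casVW bump
    ring
  have hPh : XSave.PhatOf a 7 = rhoOf a * casUV (bOfA a) := rfl
  have hPh' : XSave.PhatOf a' 7 = rhoOf a' * casUV (bump (bOfA a) 6) := by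
    show rhoOf a' * _ = _
    rw [hb']
    rfl
  have key1 := quadM3_casVW_step (bOfA a) hInBox hd h7
  have key2 := casUV_casVW_step (bOfA a)
  refine ⟨?_, ?_⟩
  · rw [hQ, hQ', hP, hP']
    linear_combination (rhoOf a * rhoOf a') * key1
  · rw [hPh, hPh', hP, hP']
    linear_combination (rhoOf a * rhoOf a') * key2

end Summit.KontsevichZagierPeriods.Zeta5Search.WedgeDictionary
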